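import Summits.BirchSwinnertonDyer.BirchSwinnertonDyer.Theorems.UniversalToricDescentHessianTwinMultTypesAtThree
import Summits.BirchSwinnertonDyer.BirchSwinnertonDyer.Theorems.Rank2ObservatoryRootNumberLocal
import Literature.NumberTheory.EllipticCurves.BSDSelmerSkinnerThmBProofs
import HarnessLib

/-!
# Route `UniversalToricDescent`, crux #3 bucket B (item 20694 `TwinSplitIMCAtThreeMult`): the SIGN of the multiplicative Hessian twin at `3` — split iff `c₆/3^{v₃(c₆)} ≡ 2 (mod 3)` (PROVED, unconditional)

Cell `bsd-wall` (W-ALL lane 3, row 2·3@3), seat `bsd-wall-utd-p2` g7 (LEAD, line mode; second item 20694),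
2026-08-28. `--supports stmt-BirchSwinnertonDyer-20694`. Fourth Hessian file: the split / non-split type of
the multiplicative Hessian twin of `…HessianTwinSemistableAtThree` / `…HessianTwinMultTypesAtThree`.

WHAT IS PROVED (no `sorry`, no named fact). For the integer model `P(S, w) = [0, −4w, 0, 4w² + S, −2Sw]` with
`3 ∤ w` and `3 ∣ Δ(P) = 64S²(w² − S)`: Mathlib's node-tangent quadratic of `P mod 3` is `w²(T² + w)`, so
* §1 `hasSplitMultiplicativeReductionAtPrime_hessianIntModelS_iff`: `P ⊗ ℚ` is SPLIT multiplicative at `3`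
  iff `3 ∣ w + 1` (`−w` is a square in `𝔽₃` iff `w ≡ 2`);
* §2 `hasSplitMultiplicativeReductionAtPrime_smul_hessePencil3_zero_one_iff`: for `μ ≠ 0`, `c₆ = μ²w`,
  `c₄³ = μ⁴S` (`w, S ∈ ℤ`, `3 ∤ w`, `3 ∣ S²(w² − S)`), EVERY model `C • D(0:1)` of the Hessian member is split
  multiplicative at `3` iff `3 ∣ w + 1`;
* §3 named twins with their sign: `exists_mult_twin_sign_of_S` (general) and
  `exists_mult_twin_sign_of_c₄_c₆` (`c₄ = 3⁴u`, `c₆ = 3⁶w`: the types `(4,6,≥10)`, `(≥5,6,9)`): a globally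
  minimal `3`-congruent twin `W′`, multiplicative at `3`, with `Split W′ 3 ↔ 3 ∣ w + 1`.

READING. `w` is the `3`-free part of `c₆` of the minimal model of the wild curve (`w = c₆/3⁶`, `c₆/3⁴`,
`c₆/3⁸` on the types `(·,6,·)`, `(·,4,·)`, `(·,8,·)`), so on every bucket-B type the Hessian twin is SPLIT
multiplicative at `3` iff `c₆/3^{v₃(c₆)} ≡ −1 (mod 3)` — a kernel form of the census's LAW B-SIGN (utd-idea g9,
`steer/B-SIGN-v1.tsv`, `1 418/1 418` two engines: the split type is a class invariant `s`), stated for every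
curve of the type. (That the SIGN of an arbitrary multiplicative twin is the same class invariant —
`MultSplitRigidAtThree` of utd-idea's sketch — is NOT proved here; only the Hessian twin's sign is computed.)

HONEST FRAMING: helper theorems; bucket B's crux is neither proved nor reduced; nothing closes; no statement
item filed (D-0014); no new definition; BSD is not proved for any curve. References: J. H. Silverman, *AEC*
VII.5 Prop. 5.1(b), VII.1 Prop. 1.3(b) [SilvermanAEC2009]; T. Fisher, Proc. LMS (3) 104 (2012) Thm. 13.2
[Fisher2012Hessian]; memo HOME/bsd-wall-utd-p2/SUPSET-AT3-v10.md §2.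
-/

set_option autoImplicit false
set_option linter.dupNamespace false

noncomputable section

namespace Summit.BirchSwinnertonDyer.BirchSwinnertonDyer.Theorems.UniversalToricDescentHessianTwin

open WeierstrassCurve Polynomial IsDedekindDomain
  Literature.NumberTheory.EllipticCurves
  Literature.NumberTheory.EllipticCurves.Rank1Residual
  Literature.NumberTheory.EllipticCurves.Fisher2012
  Summit.BirchSwinnertonDyer.Rank1Residual
  Summit.BirchSwinnertonDyer.BirchSwinnertonDyer.Rank1Residual.IntModel
  Summit.BirchSwinnertonDyer.BirchSwinnertonDyer.Rank2Observatory.RootNumber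
  Summit.BirchSwinnertonDyer.BirchSwinnertonDyer.Theorems.UniversalToricDescentTwinChoice

/-! ## §1 The sign of `P(S, w)` at `3` -/

/-- Over `𝔽₃`: for `b ≠ 0` the node-tangent quadratic of `[0, −4b, 0, 4b² + s, −2sb]` has a root iff `b = 2`
(it is `b²(T² + b)`; kernel decision). [folklore] -/
theorem exists_nodal_root_hessianShapeS_zmod_three_iff : ∀ (s b : ZMod 3), b ≠ 0 →
    ((∃ t : ZMod 3,
      (letI I : WeierstrassCurve (ZMod 3) := ⟨0, -4 * b, 0, 4 * b ^ 2 + s, -2 * s * b⟩;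
        I.c₄ * t ^ 2 + I.a₁ * I.c₄ * t - (54 * I.b₆ - 3 * I.b₂ * I.b₄ + I.a₂ * I.c₄)) = 0) ↔ b = 2) := by
  intro s b hb
  simp only [WeierstrassCurve.c₄, WeierstrassCurve.b₂, WeierstrassCurve.b₄, WeierstrassCurve.b₆]
  revert s b
  decide

/-- Reduction modulo `3` of `P(S, w)`. [folklore] -/
theorem map_hessianIntModelS_zmod_three (S w : ℤ) :
    (⟨0, -4 * w, 0, 4 * w ^ 2 + S, -2 * S * w⟩ : WeierstrassCurve ℤ).map (Int.castRingHom (ZMod 3)) =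
      ⟨0, -4 * (w : ZMod 3), 0, 4 * (w : ZMod 3) ^ 2 + (S : ZMod 3), -2 * (S : ZMod 3) * (w : ZMod 3)⟩ := by
  simp [WeierstrassCurve.map]

/-- **SIGN OF THE INTEGER MODEL.** For `3 ∤ w` and `3 ∣ Δ(P)`, `P(S,w) ⊗ ℚ` (multiplicative at `3`) is SPLIT
multiplicative at `3` iff `3 ∣ w + 1`: by the tree's `hasSplitMultiplicativeReductionAt_iff_splits`
(Silverman VII.5.1(b) on any `p`-minimal integer model) the question is whether the node-tangent quadratic
`w²(T² + w)` of `P mod 3` splits, i.e. whether `−w` is a square in `𝔽₃`. [cite: SilvermanAEC2009, VII.5 Prop. 5.1(b)] -/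
theorem hasSplitMultiplicativeReductionAtPrime_hessianIntModelS_iff (S w : ℤ) (hw : ¬ (3 : ℤ) ∣ w)
    (hΔ : (3 : ℤ) ∣ (⟨0, -4 * w, 0, 4 * w ^ 2 + S, -2 * S * w⟩ : WeierstrassCurve ℤ).Δ)
    [((⟨0, -4 * w, 0, 4 * w ^ 2 + S, -2 * S * w⟩ : WeierstrassCurve ℤ).baseChange ℚ).IsElliptic] :
    ((⟨0, -4 * w, 0, 4 * w ^ 2 + S, -2 * S * w⟩ : WeierstrassCurve ℤ).baseChange ℚ).HasSplitMultiplicativeReductionAtPrime 3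
      ↔ (3 : ℤ) ∣ w + 1 := by
  set P : WeierstrassCurve ℤ := ⟨0, -4 * w, 0, 4 * w ^ 2 + S, -2 * S * w⟩ with hP
  have hc₄ : ¬ (3 : ℤ) ∣ P.c₄ := three_not_dvd_c₄_hessianIntModelS S w hw
  set v : HeightOneSpectrum ℤ := (Rat.HeightOneSpectrum.primesEquiv (R := ℤ)).symm ⟨3, Nat.prime_three⟩
    with hvdef
  have hv : Rat.HeightOneSpectrum.primesEquiv v = ⟨3, Nat.prime_three⟩ := Equiv.apply_symm_apply _ _
  have hgen : Rat.HeightOneSpectrum.natGenerator v = 3 := Rat.natGenerator_primesEquiv_symm ⟨3, Nat.prime_three⟩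
  -- place-indexed criterion on the integer model, moved to the prime `3`
  have h1 : ∀ n : ℕ, Rat.HeightOneSpectrum.natGenerator v = n → (n : ℤ) ∣ P.Δ → ¬ (n : ℤ) ∣ P.c₄ →
      ((P.baseChange ℚ).HasSplitMultiplicativeReductionAt v ↔
        (letI I := P.map (Int.castRingHom (ZMod n));
          (C I.c₄ * X ^ 2 + C (I.a₁ * I.c₄) * X - C (54 * I.b₆ - 3 * I.b₂ * I.b₄ + I.a₂ * I.c₄)).Splits)) := by
    rintro n rfl hΔn hc₄n
    exact hasSplitMultiplicativeReductionAt_iff_splits hΔn hc₄n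
  have h2 : ∀ q : Nat.Primes, Rat.HeightOneSpectrum.primesEquiv v = q →
      ((haveI := Fact.mk q.2; (P.baseChange ℚ).HasSplitMultiplicativeReductionAtPrime (q : ℕ)) ↔
        (P.baseChange ℚ).HasSplitMultiplicativeReductionAt v) := by
    rintro q rfl
    exact hasSplitMultiplicativeReductionAtPrime_iff_hasSplitMultiplicativeReductionAt (P.baseChange ℚ) v
  rw [h2 ⟨3, Nat.prime_three⟩ hv, h1 3 hgen hΔ hc₄]
  -- the quadratic over `𝔽₃` splits iff it has a root iff `w ≡ 2 (mod 3)`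
  have hdeg := degree_nodal_eq_two P 3 hc₄
  have hw' : (w : ZMod 3) ≠ 0 := by
    rw [ne_eq, ZMod.intCast_zmod_eq_zero_iff_dvd]; exact_mod_cast hw
  have hroot := exists_nodal_root_hessianShapeS_zmod_three_iff (S : ZMod 3) (w : ZMod 3) hw'
  have hiff : (3 : ℤ) ∣ w + 1 ↔ (w : ZMod 3) = 2 := by
    have h0 := (ZMod.intCast_zmod_eq_zero_iff_dvd (w + 1) 3).symm
    push_cast at h0
    rw [h0]
    generalize (w : ZMod 3) = b
    revert b
    decide
  rw [hiff, ← hroot]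
  constructor
  · intro hs
    obtain ⟨t, ht⟩ := hs.exists_eval_eq_zero (by rw [hdeg]; decide)
    refine ⟨t, ?_⟩
    rw [hP, map_hessianIntModelS_zmod_three] at ht
    simpa only [eval_sub, eval_add, eval_mul, eval_C, eval_X, eval_pow] using ht
  · rintro ⟨t, ht⟩
    refine Splits.of_degree_eq_two hdeg (x := t) ?_
    rw [hP, map_hessianIntModelS_zmod_three]
    simpa only [eval_sub, eval_add, eval_mul, eval_C, eval_X, eval_pow] using ht

/-! ## §2 The sign of every model of the Hessian member -/

/-- **SIGN OF THE HESSIAN TWIN (general).** `μ ≠ 0`, `c₆ = μ²w`, `c₄³ = μ⁴S`, `w, S ∈ ℤ`, `3 ∤ w`,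
`3 ∣ S²(w² − S)`: every model `C • D(0:1)` of the Hessian member is split multiplicative at `3` iff
`3 ∣ w + 1`. [folklore] -/
theorem hasSplitMultiplicativeReductionAtPrime_smul_hessePencil3_zero_one_iff (W : WeierstrassCurve ℚ)
    (μ : ℚ) (w S : ℤ) (hμ : μ ≠ 0) (hw : ¬ (3 : ℤ) ∣ w) (hΔ : (3 : ℤ) ∣ S ^ 2 * (w ^ 2 - S))
    (h6 : W.c₆ = μ ^ 2 * w) (h4 : W.c₄ ^ 3 = μ ^ 4 * S) (C : VariableChange ℚ)
    [(C • hessePencil3 W.c₄ W.c₆ 0 1).IsElliptic] :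
    (C • hessePencil3 W.c₄ W.c₆ 0 1).HasSplitMultiplicativeReductionAtPrime 3 ↔ (3 : ℤ) ∣ w + 1 := by
  set M := C • hessePencil3 W.c₄ W.c₆ 0 1 with hM
  set C₁ : VariableChange ℚ :=
    ⟨Units.mk0 (3 * μ) (mul_ne_zero (by norm_num) hμ), -12 * μ ^ 2 * w, 0, 0⟩ with hC₁
  have hkey : (C₁ * C⁻¹) • M =
      (⟨0, -4 * w, 0, 4 * w ^ 2 + S, -2 * S * w⟩ : WeierstrassCurve ℤ).baseChange ℚ := by
    rw [hM, mul_smul, inv_smul_smul]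
    exact rescaleShift_hessePencil3_zero_one_int W μ w S hμ h6 h4
  haveI : ((⟨0, -4 * w, 0, 4 * w ^ 2 + S, -2 * S * w⟩ : WeierstrassCurve ℤ).baseChange ℚ).IsElliptic := by
    rw [← hkey]; infer_instance
  rw [← hasSplitMultiplicativeReductionAtPrime_smul_iff M (C₁ * C⁻¹) 3, hkey]
  refine hasSplitMultiplicativeReductionAtPrime_hessianIntModelS_iff S w hw ?_
  rw [Δ_hessianIntModelS]
  exact dvd_mul_of_dvd_right hΔ 64

/-! ## §3 Named multiplicative twins with their sign -/

/-- **MULTIPLICATIVE TWIN WITH ITS SIGN (general integer form).** Under `μ ≠ 0`, `c₆ = μ²w`, `c₄³ = μ⁴S`,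
`3 ∤ w`, `3 ∣ S`, `c₄ ≠ 0`: a globally minimal `3`-congruent twin `W′` (a global minimal model of the Hessian
member) which is multiplicative at `3` and SPLIT iff `3 ∣ w + 1`. [folklore] -/
theorem exists_mult_twin_sign_of_S (W : WeierstrassCurve ℚ) [W.IsElliptic] (μ : ℚ) (w S : ℤ) (hμ : μ ≠ 0)
    (hw : ¬ (3 : ℤ) ∣ w) (hS : (3 : ℤ) ∣ S) (h6 : W.c₆ = μ ^ 2 * w) (h4 : W.c₄ ^ 3 = μ ^ 4 * S)
    (hc4 : W.c₄ ≠ 0) :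
    ∃ (W' : WeierstrassCurve ℚ) (_ : W'.IsElliptic) (_ : W'.IsGloballyMinimal),
      O6.ModPCongruent W' W 3 ∧ Mult W' 3 ∧
        (W'.HasSplitMultiplicativeReductionAtPrime 3 ↔ (3 : ℤ) ∣ w + 1) := by
  haveI := isElliptic_hessePencil3_zero_one W hc4
  obtain ⟨C, hC⟩ := WeierstrassCurve.hasGlobalMinimalModel_rat_holds (hessePencil3 W.c₄ W.c₆ 0 1)
  haveI := hC
  have hΔ : (3 : ℤ) ∣ S ^ 2 * (w ^ 2 - S) := dvd_mul_of_dvd_left (dvd_pow hS two_ne_zero) _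
  exact ⟨C • hessePencil3 W.c₄ W.c₆ 0 1, inferInstance, hC, modPCongruent_smul_hessePencil3_zero_one W hc4 C,
    hasMultiplicativeReductionAtPrime_smul_hessePencil3_zero_one_of_S W μ w S hμ hw hS h6 h4 C,
    hasSplitMultiplicativeReductionAtPrime_smul_hessePencil3_zero_one_iff W μ w S hμ hw hΔ h6 h4 C⟩

/-- **MULTIPLICATIVE TWIN WITH ITS SIGN on the types with `v₃(c₆) = 6`** (`c₄ = 3⁴u`, `c₆ = 3⁶w`, `3 ∤ w`,
`3 ∣ u⁶(w² − u³)`: the types `(≥5, 6, 9)` and `(4, 6, ≥10)`): the Hessian twin is multiplicative at `3`,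
SPLIT iff `3 ∣ w + 1`, i.e. iff `c₆/3⁶ ≡ −1 (mod 3)`. [folklore] -/
theorem exists_mult_twin_sign_of_c₄_c₆ (W : WeierstrassCurve ℚ) [W.IsElliptic] (u w : ℤ) (hu0 : u ≠ 0)
    (hw : ¬ (3 : ℤ) ∣ w) (hΔ : (3 : ℤ) ∣ u ^ 6 * (w ^ 2 - u ^ 3)) (h4 : W.c₄ = 3 ^ 4 * u)
    (h6 : W.c₆ = 3 ^ 6 * w) :
    ∃ (W' : WeierstrassCurve ℚ) (_ : W'.IsElliptic) (_ : W'.IsGloballyMinimal),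
      O6.ModPCongruent W' W 3 ∧ Mult W' 3 ∧
        (W'.HasSplitMultiplicativeReductionAtPrime 3 ↔ (3 : ℤ) ∣ w + 1) := by
  have hc4 := c₄_ne_zero_of_eq W u hu0 h4
  haveI := isElliptic_hessePencil3_zero_one W hc4
  obtain ⟨C, hC⟩ := WeierstrassCurve.hasGlobalMinimalModel_rat_holds (hessePencil3 W.c₄ W.c₆ 0 1)
  haveI := hC
  have h6' : W.c₆ = (27 : ℚ) ^ 2 * (w : ℤ) := by rw [h6]; norm_num
  have h4' : W.c₄ ^ 3 = (27 : ℚ) ^ 4 * ((u ^ 3 : ℤ) : ℚ) := by rw [h4]; push_cast; ring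
  have hΔ' : (3 : ℤ) ∣ (u ^ 3) ^ 2 * (w ^ 2 - u ^ 3) := by
    have : (u ^ 3) ^ 2 * (w ^ 2 - u ^ 3) = u ^ 6 * (w ^ 2 - u ^ 3) := by ring
    rw [this]; exact hΔ
  exact ⟨C • hessePencil3 W.c₄ W.c₆ 0 1, inferInstance, hC, modPCongruent_smul_hessePencil3_zero_one W hc4 C,
    hasMultiplicativeReductionAtPrime_smul_hessePencil3_zero_one W u w hw hΔ h4 h6 C,
    hasSplitMultiplicativeReductionAtPrime_smul_hessePencil3_zero_one_iff W 27 w (u ^ 3) (by norm_num) hw hΔ'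
      h6' h4' C⟩

end Summit.BirchSwinnertonDyer.BirchSwinnertonDyer.Theorems.UniversalToricDescentHessianTwin

end
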